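import Summits.HodgeConjecture.HodgeConjecture.Theorems.MarkmanPartnerTransportPicardThreeK3SquaresQuotientDescentHodge
import Summits.HodgeConjecture.HodgeConjecture.Theorems.MarkmanPartnerTransportPicardThreeK3SquaresQuotientDescentTranspose

/-!
# Route MarkmanPartnerTransport · crux `PicardThreeK3Squares` (stmt-HodgeConjecture-19652) —
# HC⁴ for K3 squares is INVARIANT along an algebraic similitude datum (both directions)

Assembles `…QuotientDescentHodge` (HC⁴(Z ⊗ Z) ⟹ HC⁴(X ⊗ X) along a datum `γ` for `X` from `Z`) and
`…QuotientDescentTranspose` (`ᵗγ` is a datum for `Z` from `X`; converse transport of the sector clause):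

* `hodgeConjectureFor_square_iff_of_datum` — **HC⁴(Z ⊗ Z) ⟺ HC⁴(X ⊗ X)** whenever an algebraic class on
  `X ⊗ Z` acts as a rational, Hodge-type preserving similitude of `T(Z)` onto `T(X)` with rational
  multiplier `m ≠ 0` (marked projective K3 surfaces); no named fact. With Varesco's quotient data
  (`Varesco2023_quotientSimilitude_two/three_…`, automatic at `ρ ≥ 11` resp. `≥ 15`): the Hodge conjecture
  for `X × X` is EQUIVALENT to the Hodge conjecture for `Z × Z`, `Z` the Nikulin (resp. order-`3`)
  quotient partner — so the open residue of the crux is closed under passing to quotient partners.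

No definition, no sorry. Prover seat hodge-nonav-19652-p1 (gen 5), `--supports stmt-HodgeConjecture-19652`.

References: M. Varesco, Math. Z. 305 (2023) §2; W. Fulton, *Intersection theory*, §16.1 Prop. 16.1.1.
-/

set_option linter.dupNamespace false

noncomputable section

namespace Summit.HodgeConjecture.HodgeConjecture.Theorems.MarkmanPartnerTransport.QuotientSimilitude

open scoped Manifold
open Module CategoryTheory MonoidalCategory CartesianMonoidalCategory
open Literature.AlgebraicGeometry Literature.AlgebraicGeometry.Motives Literature.AlgebraicGeometry.HodgeTheory
open Literature.AlgebraicGeometry.Surfaces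
open Literature.AlgebraicTopology.SingularHomology
open Summit.HodgeConjecture.HodgeConjecture.Theorems
open Summit.HodgeConjecture.HodgeConjecture.Theorems.NikulinTwinTransport
open Summit.HodgeConjecture.HodgeConjecture.Theorems.MarkmanPartnerTransport

variable {S Z : SchemeOver ℂ}

/-- `MarkedK3[S, η, p, x]`: VERBATIM the `let MarkedK3 := …` binder of the route declaration
`PicardThreeK3Squares`. Local notation only. -/
local notation3 (prettyPrint := false) "MarkedK3[" S ", " η ", " p ", " x "]" =>
  (p ≠ 0 ∧ (IsIntegralClass p ∧
    (∀ q : complexBetti S (2 * 2), IsIntegralClass q → ∃ n : ℤ, q = n • p) ∧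
    (∀ c : complexBetti S (2 * 1), IsIntegralClass c ↔ ∃ v : K3Index → ℤ, η c = fun i => (v i : ℂ)) ∧
    (∀ a b : complexBetti S (2 * 1),
      cupProduct (rfl : 2 * 1 + 2 * 1 = 2 * 2) a b = k3Form (η a) (η b) • p) ∧
    IsOfHodgeType 2 S (2 * 1) 2 0 (LinearEquiv.symm η x) ∧
    (∀ τ : complexBetti S (2 * 1), IsOfHodgeType 2 S (2 * 1) 2 0 τ →
      ∃ t : ℂ, τ = t • LinearEquiv.symm η x)) ∧
    (k3Form x x = 0 ∧ 0 < (k3Form (star x) x).re ∧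
      ∃ u : K3Index → ℤ, k3Form (fun i => (u i : ℂ)) x = 0 ∧ 0 < ∑ i, ∑ j, u i * k3Gram i j * u j))

/-- `Corr[μ, X, Y, hX, hY ; γ, y] = fst_* (snd^* y ∪ γ)` (`hX hY : IsSmoothProjective 2 _`). Local notation only. -/
local notation3 (prettyPrint := false) "Corr[" μ ", " X ", " Y ", " hX ", " hY " ; " γ ", " y "]" =>
  complexGysin μ (IsSmoothProjective.tensor_holds hX hY) hX (SemiCartesianMonoidalCategory.fst X Y)
    (rfl : 2 * 1 + 2 * 2 + 2 * 2 = 2 * 1 + 2 * (2 + 2))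
    (cupProduct (rfl : 2 * 1 + 2 * 2 = 2 * 1 + 2 * 2)
      (complexBetti.map (SemiCartesianMonoidalCategory.snd X Y) (2 * 1) y) γ)

/-- `Transp[X, Y ; γ] = swap^* γ`. Local notation only. -/
local notation3 (prettyPrint := false) "Transp[" X ", " Y " ; " γ "]" =>
  complexBetti.map (CartesianMonoidalCategory.lift (SemiCartesianMonoidalCategory.snd Y X)
    (SemiCartesianMonoidalCategory.fst Y X)) (2 * 2) γ

/-- `Datum[X, Z, hX, hZ, η, ηZ ; γ, m]`: `γ` is an algebraic class on `X ⊗ Z` whose action `[γ]_*` is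
rational, Hodge-type preserving, maps `T(Z)` onto `T(X)` and scales the forms there by `m` in the
markings. Local notation only. -/
local notation3 (prettyPrint := false) "Datum[" X ", " Z ", " hX ", " hZ ", " η ", " ηZ " ; " γ ", " m "]" =>
  (γ ∈ algebraicClasses (X ⊗ Z) 2 ∧
    (∀ y, IsRationalClass y → IsRationalClass (Corr[complexOrientationFamily, X, Z, hX, hZ ; γ, y])) ∧
    (∀ (i j : ℕ) y, IsOfHodgeType 2 Z (2 * 1) i j y →
      IsOfHodgeType 2 X (2 * 1) i j (Corr[complexOrientationFamily, X, Z, hX, hZ ; γ, y])) ∧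
    (∀ y ∈ transcendentalSubspace Z,
      Corr[complexOrientationFamily, X, Z, hX, hZ ; γ, y] ∈ transcendentalSubspace X) ∧
    (∀ z ∈ transcendentalSubspace X, ∃ y ∈ transcendentalSubspace Z,
      Corr[complexOrientationFamily, X, Z, hX, hZ ; γ, y] = z) ∧
    (∀ a ∈ transcendentalSubspace Z, ∀ b ∈ transcendentalSubspace Z,
      k3Form (η (Corr[complexOrientationFamily, X, Z, hX, hZ ; γ, a]))
        (η (Corr[complexOrientationFamily, X, Z, hX, hZ ; γ, b])) = m * k3Form (ηZ a) (ηZ b)))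

/-! ### The equivalence -/

/-- **HC⁴(Z ⊗ Z) ⟺ HC⁴(X ⊗ X) along an algebraic similitude datum `(Z, γ)` for `X`** (no named fact):
`⇒` is `hodgeConjectureFor_square_of_datum`; `⇐` is the same transport along the transposed datum `ᵗγ`
(`cycleInducedSector_of_datum_symm`) between Varesco's equivalences HC⁴ ⟺ sector clause
(`SectorIff.cycleInducedSector_of_hodgeConjectureFor_square`,
`CycleInducedSector.hodgeConjectureFor_square_of_cycleInducedSector`). [cite: Varesco2023, §2 (p. 8)]
[cite: Fulton1998, §16.1 Prop. 16.1.1] -/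
theorem hodgeConjectureFor_square_iff_of_datum (hS : IsK3Surface S)
    (η : complexBetti S (2 * 1) ≃ₗ[ℂ] (K3Index → ℂ)) (p : complexBetti S (2 * 2)) (x : K3Index → ℂ)
    (hM : MarkedK3[S, η, p, x]) (hZ : IsK3Surface Z)
    (ηZ : complexBetti Z (2 * 1) ≃ₗ[ℂ] (K3Index → ℂ)) (pZ : complexBetti Z (2 * 2)) (xZ : K3Index → ℂ)
    (hMZ : MarkedK3[Z, ηZ, pZ, xZ]) {m : ℂ} (hm : m ≠ 0) (hmrat : ∃ q : ℚ, (q : ℂ) = m)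
    (γ : complexBetti (S ⊗ Z) (2 * 2)) (hD : Datum[S, Z, hS.1, hZ.1, η, ηZ ; γ, m]) :
    HodgeConjectureFor 4 (Z ⊗ Z) ↔ HodgeConjectureFor 4 (S ⊗ S) :=
  ⟨hodgeConjectureFor_square_of_datum hS η p x hM hZ ηZ pZ xZ hMZ hm hmrat γ hD, fun h ↦
    CycleInducedSector.hodgeConjectureFor_square_of_cycleInducedSector complexOrientationFamily hZ.1
      (cycleInducedSector_of_datum_symm hS η p x hM hZ ηZ pZ xZ hMZ hm hmrat γ hD
        (SectorIff.cycleInducedSector_of_hodgeConjectureFor_square complexOrientationFamily hS.1 h))⟩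

/-- **HC⁴(X ⊗ X) ⟹ HC⁴(Z ⊗ Z)** (the converse direction alone, for citation).
[cite: Varesco2023, §2 (p. 8)] -/
theorem hodgeConjectureFor_square_of_datum_symm (hS : IsK3Surface S)
    (η : complexBetti S (2 * 1) ≃ₗ[ℂ] (K3Index → ℂ)) (p : complexBetti S (2 * 2)) (x : K3Index → ℂ)
    (hM : MarkedK3[S, η, p, x]) (hZ : IsK3Surface Z)
    (ηZ : complexBetti Z (2 * 1) ≃ₗ[ℂ] (K3Index → ℂ)) (pZ : complexBetti Z (2 * 2)) (xZ : K3Index → ℂ)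
    (hMZ : MarkedK3[Z, ηZ, pZ, xZ]) {m : ℂ} (hm : m ≠ 0) (hmrat : ∃ q : ℚ, (q : ℂ) = m)
    (γ : complexBetti (S ⊗ Z) (2 * 2)) (hD : Datum[S, Z, hS.1, hZ.1, η, ηZ ; γ, m])
    (h : HodgeConjectureFor 4 (S ⊗ S)) : HodgeConjectureFor 4 (Z ⊗ Z) :=
  (hodgeConjectureFor_square_iff_of_datum hS η p x hM hZ ηZ pZ xZ hMZ hm hmrat γ hD).2 h

end Summit.HodgeConjecture.HodgeConjecture.Theorems.MarkmanPartnerTransport.QuotientSimilitude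

end
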